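import Summits.HodgeConjecture.HodgeConjecture.Theses.HolomorphicityRate
import Literature.AlgebraicGeometry.HodgeTheory.HodgeRiemannDegreeOneProofs
import Summits.HodgeConjecture.HodgeConjecture.Theorems.HolomorphicityRateSuperThresholdRigidityOfHodgeBelowMiddle
import HarnessLib

/-!
# Route `HolomorphicityRate`: the aside `SuperThresholdRigidity` (R2, stmt-HodgeConjecture-2737) implies its pinned
# successor `SuperThresholdRigidityPinned` (R2′, stmt-HodgeConjecture-18022), and R2′ folds onto the Hodge conjecture
# at or below the middle — with no threshold lemma — holding outright in codimensions `1` and `n - 1`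

Crux item `stmt-HodgeConjecture-2737` (`HolomorphicityRate.SuperThresholdRigidity`, R2 of the card "Hodge as a rate")
was re-triaged to an aside on 2026-08-17 and replaced, as a crux, by `HolomorphicityRate.SuperThresholdRigidityPinned`
(R2′): the same rigidity statement on the PINNED Kodaira ray `γ_k = m•c + (a_k d)•hᵖ` of a hard-Lefschetz datum `Λ`
with Kähler hyperplane class `h`, for a RATIONAL class `c` of type `(p,p)`, `1 ≤ p < n`, the nearly-holomorphic
clause packaged as `Literature.Geometry.Kaehler.IsNearlyHolomorphicCycleSupport`. This file records, as helpers of the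
aside (`--supports stmt-HodgeConjecture-2737`), what the four leads of its only line (`registered`) established,
transported to the successor so that its first lead starts from it:

* `cupPowTwo_hyperplaneClass_mem_algebraicClasses_of_hardLefschetzNFold` — `hᵖ ∈ Nᵖ H²ᵖ` for EVERY hard-Lefschetz
  datum (iterate the structure field `lefschetzOperator_mem_algebraicClasses` from `h⁰ = 1 ∈ N⁰ H⁰ = H⁰`); with
  `IsRationalClass.cupPowTwo` this makes `hp := hᵖ` an admissible ray direction of R2.
* `superThresholdRigidityPinned_of_superThresholdRigidity` — **R2 ⟹ R2′** (specialisation `hp := hᵖ`,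
  `a_k := a_k·d`, `C := C·d`; the packaged clause is the inline clause by
  `isNearlyHolomorphicCycleSupport_toRiemannianMetric_iff`). Hence every proof of the aside closes the successor.
* `superThresholdRigidityPinned_at_of_hodgeFor` — **R2′ at `(n, p, X)` from the Hodge conjecture for rational `(p,p)`
  classes of codimension `p` on `X`**, and the representatives are IDLE in it: `c` is rational `(p,p)` BY HYPOTHESIS
  (R2 needed the threshold lemma E2 for this), so `c` is algebraic, so is every ray class `γ_k`, and an algebraic class
  dies off a closed analytic subset with regular points of codimension `≥ p` (GAGA, `stub_analyticSupportOfAlgebraic`).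
* `superThresholdRigidityPinned_of_hodgeBelowMiddle` — **HC at or below the middle (`2 ≤ p ≤ n/2`) ⟹ R2′**, with NO
  threshold lemma (compare `superThresholdRigidity_of_hodgeBelowMiddle`, which needs E2): the successor crux folds onto
  the same summit-equivalent stub `stub_hodgeBelowMiddle` (`hodgeConjecture_iff_hodgeBelowMiddle`) as R2 and R1 did;
  `superThresholdRigidityPinned_of_hodgeConjecture` — HC ⟹ R2′ (the successor is refutable only together with HC).
* `superThresholdRigidityPinned_at_of_eq_one_or_succ_eq`, `superThresholdRigidityPinned_of_le_three` — **R2′ holds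
  OUTRIGHT for `p ∈ {1, n - 1}` and for all `n ≤ 3`** (Lefschetz `(1,1)` and hard Lefschetz, `hodgeFor_of_eq_one_or_succ_eq`).

Reading for the planner: as typed, R2′ is implied by HC≤middle by pure logic over landed pieces, its nearly-holomorphic
hypothesis unused; a line for R2′ whose composition passes through "`γ_k` is algebraic" has the summit as its only
open stub, exactly like line `registered` of R2. A non-folding rigidity statement must conclude something HC does not
hand out for free — a conclusion tied to the GIVEN representative `S_k` (the analytic support inside a prescribed
neighbourhood of `S_k`, or `S_k` itself corrected by a normal graph of controlled size), i.e. the quantitative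
fixed-`k` Newton–Kuranishi statement.

## References

* C. Voisin, *Hodge Theory and Complex Algebraic Geometry I* (2002), Thm. 6.25, §7.1.2, §11.1.2, Thm. 11.30; *II* (2003),
  §9.2.4 Prop. 9.20. [VoisinHodgeI2002] [VoisinHodgeII2003]
* J.-P. Serre, *Géométrie algébrique et géométrie analytique* (1956), §2 n°5. [SerreGAGA1956]
* A. Hatcher, *Algebraic Topology* (2002), §3.2. [HatcherAT2002]
* P. Deligne, *The Hodge conjecture* (Clay, 2000), §1. [Deligne2000]
-/

namespace Summit.HodgeConjecture.HodgeConjecture.Theses.HolomorphicityRate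
open scoped BigOperators Topology Manifold Classical MeasureTheory ProbabilityTheory Matrix InnerProductSpace ComplexConjugate ContinuousMap in
open Filter Set Function TopologicalSpace MeasureTheory in
/-- **Record of the dropped route item `SuperThresholdRigidityPinned`** = stmt-HodgeConjecture-18022 (ledger signature verbatim; NOT a route
item): route HolomorphicityRate (2026-08-17T11:20Z) replaced `SuperThresholdRigidityPinned` (stmt-18022) by stmt-18080 under a new name. The declaration `Summit.HodgeConjecture.HodgeConjecture.Theses.HolomorphicityRate.SuperThresholdRigidityPinned`
therefore no longer exists in the route file and this accepted module stopped elaborating (stale olean;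
buildfix lane 2026-08-19). Re-created here under its original name so the result keeps building; the
statement of every previously accepted declaration in this file is unchanged. -/
def SuperThresholdRigidityPinned : Prop :=
  ∀ (n p : ℕ) (X : Literature.AlgebraicGeometry.Motives.SchemeOver ℂ), Literature.AlgebraicGeometry.Motives.IsSmoothProjective n X → 1 ≤ p → p < n → ∀ (A : Literature.AlgebraicGeometry.HodgeTheory.HodgeModel n X) (Λ : Literature.AlgebraicGeometry.HodgeTheory.HardLefschetzNFold n X), Literature.AlgebraicGeometry.HodgeTheory.IsKaehlerClass n X Λ.hyperplaneClass → ∀ (g : Bundle.ContMDiffRiemannianMetric 𝓘(ℝ, A.model) ((⊤ : ℕ∞) : WithTop ℕ∞) A.model (fun x : A.carrier => TangentSpace 𝓘(ℝ, A.model) x)) (c : Literature.AlgebraicGeometry.HodgeTheory.complexBetti X (2 * p)) (m d : ℕ) (C : ℝ) (a : ℕ → ℕ) (δ C' : ℝ), Literature.AlgebraicGeometry.HodgeTheory.IsRationalClass c → A.pullback (2 * p) c ∈ A.hodgePQ (2 * p) p p → 0 < m → 0 < d → (∀ k, (a k : ℝ) ≤ C * (k : ℝ) ^ p) → 0 < δ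 → (∃ᶠ k : ℕ in Filter.atTop, ∃ S Sg : Set A.carrier, Literature.Geometry.Kaehler.IsNearlyHolomorphicCycleSupport g.toRiemannianMetric p (C' * (k : ℝ) ^ (-((p : ℝ) + δ))) S Sg ∧ Literature.AlgebraicTopology.SingularHomology.singularCohomology.map ℂ ℂ (⟨Subtype.val, continuous_subtype_val⟩ : C({x : A.carrier // x ∉ S}, A.carrier)) (2 * p) (A.pullback (2 * p) ((m : ℂ) • c + ((a k * d : ℕ) : ℂ) • Literature.AlgebraicGeometry.HodgeTheory.cupPowTwo Λ.hyperplaneClass p)) = 0) → ∃ (k : ℕ) (S : Set A.carrier), (Literature.Geometry.Kaehler.IsAnalyticSet 𝓘(ℂ, A.model) S ∧ ∀ x ∈ Literature.Geometry.Kaehler.regularLocus 𝓘(ℂ, A.model) S, ∀ q : ℕ, Literature.Geometry.Kaehler.IsRegularPointOfCodim 𝓘(ℂ, A.model) S q x → p ≤ q) ∧ Literature.AlgebraicTopology.SingularHomology.singularCohomology.map ℂ ℂ (⟨Subtype.val, continuous_subtype_val⟩ : C({x : A.carrier // x ∉ S}, A.carrier)) (2 * p) (A.pullback (2 * p) ((m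 : ℂ) • c + ((a k * d : ℕ) : ℂ) • Literature.AlgebraicGeometry.HodgeTheory.cupPowTwo Λ.hyperplaneClass p)) = 0
end Summit.HodgeConjecture.HodgeConjecture.Theses.HolomorphicityRate


noncomputable section

open scoped Manifold ContDiff Topology
open Filter Set

-- `Summit.HodgeConjecture.HodgeConjecture.Theorems` is the mandated namespace (single-conjunct summit:
-- Sub = Summit), which `linter.dupNamespace` flags on every declaration; the lakefile turns the
-- linter off tree-wide (weak option), restated here so stand-alone elaboration is warning-free too.
set_option linter.dupNamespace false

namespace Summit.HodgeConjecture.HodgeConjecture.Theorems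

open Literature.AlgebraicGeometry.HodgeTheory Literature.AlgebraicGeometry.Motives
  Literature.AlgebraicTopology.SingularHomology Literature.Geometry.Kaehler
  Summit.HodgeConjecture.HodgeConjecture.Theses.HolomorphicityRate

variable {n : ℕ} {X : Literature.AlgebraicGeometry.Motives.SchemeOver ℂ}

/-! ### Powers of the hyperplane class are algebraic -/

/-- **`hᵖ ∈ Nᵖ H²ᵖ(X(ℂ); ℂ)` for the hyperplane class `h` of any hard-Lefschetz datum**: `h⁰ = 1` lies in
`N⁰ H⁰ = H⁰` (`algebraicClasses_zero`), and `hᵖ⁺¹ = hᵖ ⌣ h = h ⌣ hᵖ = L hᵖ` (even-degree classes commute,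
`cupPowTwo_cupProduct_comm`) stays algebraic by the structure field `lefschetzOperator_mem_algebraicClasses`
(`[Z] ↦ [H · Z]`). [cite: VoisinHodgeII2003, §9.2.4 Prop. 9.20] [cite: HatcherAT2002, §3.2 Thm. 3.11] -/
theorem cupPowTwo_hyperplaneClass_mem_algebraicClasses_of_hardLefschetzNFold (Λ : HardLefschetzNFold n X) :
    ∀ p : ℕ, cupPowTwo Λ.hyperplaneClass p ∈ algebraicClasses X p
  | 0 => by
    rw [cupPowTwo_zero, algebraicClasses_zero]
    exact Submodule.mem_top
  | p + 1 => by
    rw [cupPowTwo_succ, HodgeRiemannDegreeOne.cupPowTwo_cupProduct_comm Λ.hyperplaneClass p 2 (2 * (p + 1))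
      (two_mul_add_two p) (two_add_two_mul p) Λ.hyperplaneClass]
    exact Λ.lefschetzOperator_mem_algebraicClasses p _
      (cupPowTwo_hyperplaneClass_mem_algebraicClasses_of_hardLefschetzNFold Λ p)

/-! ### R2 ⟹ R2′ -/

/-- **The aside `SuperThresholdRigidity` implies its pinned successor `SuperThresholdRigidityPinned`.** Specialise R2
to the ray direction `hp := hᵖ` (rational by `IsRationalClass.cupPowTwo`, algebraic by
`cupPowTwo_hyperplaneClass_mem_algebraicClasses_of_hardLefschetzNFold`), the integers `a_k·d ≤ (C·d)·kᵖ`, and the same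
`m, δ, C'`; the packaged clause `IsNearlyHolomorphicCycleSupport g.toRiemannianMetric p t S Sg` of R2′ is the inline
clause of R2 (`isNearlyHolomorphicCycleSupport_toRiemannianMetric_iff`, `Iff.rfl`). The rationality and Hodge type of
`c`, the Kähler hypothesis on `h` and `1 ≤ p < n` are not used. [cite: VoisinHodgeI2002, §11.1.2] -/
theorem superThresholdRigidityPinned_of_superThresholdRigidity : Summit.HodgeConjecture.HodgeConjecture.Theses.HolomorphicityRate.SuperThresholdRigidity → Summit.HodgeConjecture.HodgeConjecture.Theses.HolomorphicityRate.SuperThresholdRigidityPinned := by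
  intro hR2 n p X hX _hp1 hpn A Λ _hK g c m d C a δ C' _hc _hcpp hm _hd hbud hδ hfreq
  have hrat : IsRationalClass (cupPowTwo Λ.hyperplaneClass p) := Λ.isRationalClass_hyperplaneClass.cupPowTwo p
  have halg : cupPowTwo Λ.hyperplaneClass p ∈ algebraicClasses X p :=
    cupPowTwo_hyperplaneClass_mem_algebraicClasses_of_hardLefschetzNFold Λ p
  have hbud' : ∀ k, (((fun k => a k * d) k : ℕ) : ℝ) ≤ C * d * (k : ℝ) ^ p := by
    intro k
    have hd0 : (0 : ℝ) ≤ d := Nat.cast_nonneg d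
    have h1 := mul_le_mul_of_nonneg_right (hbud k) hd0
    simp only [Nat.cast_mul]
    calc (a k : ℝ) * d ≤ C * (k : ℝ) ^ p * d := h1
      _ = C * d * (k : ℝ) ^ p := by ring
  have hfreq' := hfreq.mono fun k ⟨S, Sg, hS, hsupp⟩ =>
    (⟨S, Sg, (isNearlyHolomorphicCycleSupport_toRiemannianMetric_iff g).1 hS, hsupp⟩ :
      ∃ S Sg : Set A.carrier, (IsClosed S ∧ IsClosed Sg ∧ Sg ⊆ S ∧ IsConnected (S \ Sg) ∧ (∀ x ∈ Sg, Literature.Geometry.Kaehler.IsAnalyticSetAt 𝓘(ℂ, A.model) S x) ∧ (∃ T : Set A.carrier, Sg ⊆ T ∧ (Literature.Geometry.Kaehler.IsAnalyticSet 𝓘(ℂ, A.model) T ∧ ∀ x ∈ Literature.Geometry.Kaehler.regularLocus 𝓘(ℂ, A.model) T, ∀ q : ℕ, Literature.Geometry.Kaehler.IsRegularPointOfCodim 𝓘(ℂ, A.model) T q x → p + 1 ≤ q)) ∧ (∀ x ∈ S \ Sg, ∃ U : Set A.carrier, IsOpen U ∧ x ∈ U ∧ ∃ f : A.carrier → (Fin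 (2 * p) → ℝ), ContMDiffOn 𝓘(ℝ, A.model) 𝓘(ℝ, Fin (2 * p) → ℝ) 1 f U ∧ S ∩ U = U ∩ f ⁻¹' {0} ∧ Function.Surjective (mfderiv 𝓘(ℝ, A.model) 𝓘(ℝ, Fin (2 * p) → ℝ) f x) ∧ ∀ v : TangentSpace 𝓘(ℝ, A.model) x, mfderiv 𝓘(ℝ, A.model) 𝓘(ℝ, Fin (2 * p) → ℝ) f x v = 0 → ∃ w : TangentSpace 𝓘(ℝ, A.model) x, mfderiv 𝓘(ℝ, A.model) 𝓘(ℝ, Fin (2 * p) → ℝ) f x w = 0 ∧ g.inner x (Literature.Geometry.Kaehler.tangentJ A.model x v - w) (Literature.Geometry.Kaehler.tangentJ A.model x v - w) ≤ (C' * (k : ℝ) ^ (-((p : ℝ) + δ))) ^ 2 * g.inner x v v)) ∧ Literature.AlgebraicTopology.SingularHomology.singularCohomology.map ℂ ℂ (⟨Subtype.val, continuous_subtype_val⟩ : C({x : A.carrier // x ∉ S}, A.carrier)) (2 * p) (A.pullback (2 * p) (((m : ℂ) • c + (((fun k => a k * d) k : ℕ) : ℂ) • cupPowTwo Λ.hyperplaneClass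 p))) = 0)
  exact hR2 n p X hX hpn.le A g c (cupPowTwo Λ.hyperplaneClass p) m (C * d) (fun k => a k * d) δ C' hrat halg hm
    hbud' hδ hfreq'

/-! ### R2′ from the Hodge conjecture in codimension `p`: the representatives are idle -/

/-- **R2′ at `(n, p, X)`, granted the Hodge conjecture for rational `(p,p)` classes of codimension `p` on `X`** (`hHC`,
in every Hodge model). The class `c` of R2′ is rational and of type `(p,p)` by hypothesis, hence algebraic (`hHC`);
`hᵖ` is algebraic (`cupPowTwo_hyperplaneClass_mem_algebraicClasses_of_hardLefschetzNFold`), so every ray class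
`γ_k = m•c + (a_k d)•hᵖ` is algebraic, and an algebraic class dies off a closed analytic subset all of whose regular
points have codimension `≥ p` (GAGA, `stub_analyticSupportOfAlgebraic`). The nearly-holomorphic representatives are
used only to name one `k` (any `k` would do). [cite: VoisinHodgeI2002, §11.1.2] [cite: SerreGAGA1956, §2 n°5] -/
theorem superThresholdRigidityPinned_at_of_hodgeFor (n p : ℕ) (X : Literature.AlgebraicGeometry.Motives.SchemeOver ℂ)
    (hX : Literature.AlgebraicGeometry.Motives.IsSmoothProjective n X)
    (hHC : ∀ (A : Literature.AlgebraicGeometry.HodgeTheory.HodgeModel n X) (r : Literature.AlgebraicGeometry.HodgeTheory.complexBetti X (2 * p)), Literature.AlgebraicGeometry.HodgeTheory.IsRationalClass r → A.pullback (2 * p) r ∈ A.hodgePQ (2 * p) p p → r ∈ Literature.AlgebraicGeometry.HodgeTheory.algebraicClasses X p) :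
    1 ≤ p → p < n → ∀ (A : Literature.AlgebraicGeometry.HodgeTheory.HodgeModel n X) (Λ : Literature.AlgebraicGeometry.HodgeTheory.HardLefschetzNFold n X), Literature.AlgebraicGeometry.HodgeTheory.IsKaehlerClass n X Λ.hyperplaneClass → ∀ (g : Bundle.ContMDiffRiemannianMetric 𝓘(ℝ, A.model) ((⊤ : ℕ∞) : WithTop ℕ∞) A.model (fun x : A.carrier => TangentSpace 𝓘(ℝ, A.model) x)) (c : Literature.AlgebraicGeometry.HodgeTheory.complexBetti X (2 * p)) (m d : ℕ) (C : ℝ) (a : ℕ → ℕ) (δ C' : ℝ), Literature.AlgebraicGeometry.HodgeTheory.IsRationalClass c → A.pullback (2 * p) c ∈ A.hodgePQ (2 * p) p p → 0 < m → 0 < d → (∀ k, (a k : ℝ) ≤ C * (k : ℝ) ^ p) → 0 < δ → (∃ᶠ k : ℕ in Filter.atTop, ∃ S Sg : Set A.carrier, Literature.Geometry.Kaehler.IsNearlyHolomorphicCycleSupport g.toRiemannianMetric p (C' * (k : ℝ) ^ (-((p : ℝ) + δ))) S Sg ∧ Literature.AlgebraicTopology.SingularHomology.singularCohomology.map ℂ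 ℂ (⟨Subtype.val, continuous_subtype_val⟩ : C({x : A.carrier // x ∉ S}, A.carrier)) (2 * p) (A.pullback (2 * p) ((m : ℂ) • c + ((a k * d : ℕ) : ℂ) • Literature.AlgebraicGeometry.HodgeTheory.cupPowTwo Λ.hyperplaneClass p)) = 0) → ∃ (k : ℕ) (S : Set A.carrier), (Literature.Geometry.Kaehler.IsAnalyticSet 𝓘(ℂ, A.model) S ∧ ∀ x ∈ Literature.Geometry.Kaehler.regularLocus 𝓘(ℂ, A.model) S, ∀ q : ℕ, Literature.Geometry.Kaehler.IsRegularPointOfCodim 𝓘(ℂ, A.model) S q x → p ≤ q) ∧ Literature.AlgebraicTopology.SingularHomology.singularCohomology.map ℂ ℂ (⟨Subtype.val, continuous_subtype_val⟩ : C({x : A.carrier // x ∉ S}, A.carrier)) (2 * p) (A.pullback (2 * p) ((m : ℂ) • c + ((a k * d : ℕ) : ℂ) • Literature.AlgebraicGeometry.HodgeTheory.cupPowTwo Λ.hyperplaneClass p)) = 0 := by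
  intro _hp1 _hpn A Λ _hK g c m d C a δ C' hc hcpp _hm _hd _hbud _hδ hfreq
  obtain ⟨k, _hk⟩ := hfreq.exists
  have hcalg : c ∈ algebraicClasses X p := hHC A c hc hcpp
  have hγ : ((m : ℂ) • c + ((a k * d : ℕ) : ℂ) • cupPowTwo Λ.hyperplaneClass p) ∈ algebraicClasses X p :=
    Submodule.add_mem _ (Submodule.smul_mem _ _ hcalg)
      (Submodule.smul_mem _ _ (cupPowTwo_hyperplaneClass_mem_algebraicClasses_of_hardLefschetzNFold Λ p))
  obtain ⟨S, hS, hsupp⟩ := stub_analyticSupportOfAlgebraic n p X hX A _ hγ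
  exact ⟨k, S, hS, hsupp⟩

/-- **HC at or below the middle (`2 ≤ p ≤ n/2`) ⟹ the successor crux `SuperThresholdRigidityPinned`** (route decl by
name), with NO threshold lemma: the hypothesis is VERBATIM the summit-equivalent stub `stub_hodgeBelowMiddle` of the
lines `registered` of R1 and R2 (`hodgeConjecture_iff_hodgeBelowMiddle`), which supplies HC in every codimension
`0 < p ≤ n` (`hodgeFor_of_hodgeBelowMiddle`: Lefschetz `(1,1)`, top degree, hard Lefschetz). Compare
`superThresholdRigidity_of_hodgeBelowMiddle` (R2 ⟸ E2 ∧ the same stub). [cite: VoisinHodgeI2002, Thm. 6.25, Thm. 11.30 and §11.1.2]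
[cite: KerrPearlstein2011, §3.1] -/
theorem superThresholdRigidityPinned_of_hodgeBelowMiddle
    (hH : ∀ (n p : ℕ) (X : Literature.AlgebraicGeometry.Motives.SchemeOver ℂ), Literature.AlgebraicGeometry.Motives.IsSmoothProjective n X → 2 ≤ p → 2 * p ≤ n → ∀ (A : Literature.AlgebraicGeometry.HodgeTheory.HodgeModel n X) (c : Literature.AlgebraicGeometry.HodgeTheory.complexBetti X (2 * p)), Literature.AlgebraicGeometry.HodgeTheory.IsRationalClass c → A.pullback (2 * p) c ∈ A.hodgePQ (2 * p) p p → c ∈ Literature.AlgebraicGeometry.HodgeTheory.algebraicClasses X p) :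
    SuperThresholdRigidityPinned :=
  fun n p X hX hp1 hpn => superThresholdRigidityPinned_at_of_hodgeFor n p X hX
    (fun A r hr hrpp => hodgeFor_of_hodgeBelowMiddle hH hX hpn.le hp1 A r hr hrpp) hp1 hpn

/-- **HC ⟹ the successor crux `SuperThresholdRigidityPinned`**: like the aside R2 (`superThresholdRigidity_of_hodgeConjecture`,
which also needs E2), R2′ is refutable only together with the Hodge conjecture. [cite: Deligne2000, §1] -/
theorem superThresholdRigidityPinned_of_hodgeConjecture (hHC : _root_.HodgeConjecture) : SuperThresholdRigidityPinned :=
  fun n p X hX hp1 hpn => superThresholdRigidityPinned_at_of_hodgeFor n p X hX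
    (fun A r hr hrpp => hodgeFor_of_hodgeConjecture hHC hX A r hr hrpp) hp1 hpn

/-- **R2′ OUTRIGHT at `(n, p, X)` for `p = 1` or `p = n - 1`** (no Hodge conjecture, no threshold lemma: Lefschetz
`(1,1)` and hard Lefschetz are theorems of the tree, `hodgeFor_of_eq_one_or_succ_eq`). The statement is the body of
`SuperThresholdRigidityPinned` at `(n, p, X)` with the extra hypothesis `p = 1 ∨ p + 1 = n`.
[cite: VoisinHodgeI2002, Thm. 6.25, Thm. 11.30 and §11.1.2] -/
theorem superThresholdRigidityPinned_at_of_eq_one_or_succ_eq : ∀ (n p : ℕ) (X : Literature.AlgebraicGeometry.Motives.SchemeOver ℂ), Literature.AlgebraicGeometry.Motives.IsSmoothProjective n X → (p = 1 ∨ p + 1 = n) → 1 ≤ p → p < n → ∀ (A : Literature.AlgebraicGeometry.HodgeTheory.HodgeModel n X) (Λ : Literature.AlgebraicGeometry.HodgeTheory.HardLefschetzNFold n X), Literature.AlgebraicGeometry.HodgeTheory.IsKaehlerClass n X Λ.hyperplaneClass → ∀ (g : Bundle.ContMDiffRiemannianMetric 𝓘(ℝ, A.model) ((⊤ : ℕ∞)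 : WithTop ℕ∞) A.model (fun x : A.carrier => TangentSpace 𝓘(ℝ, A.model) x)) (c : Literature.AlgebraicGeometry.HodgeTheory.complexBetti X (2 * p)) (m d : ℕ) (C : ℝ) (a : ℕ → ℕ) (δ C' : ℝ), Literature.AlgebraicGeometry.HodgeTheory.IsRationalClass c → A.pullback (2 * p) c ∈ A.hodgePQ (2 * p) p p → 0 < m → 0 < d → (∀ k, (a k : ℝ) ≤ C * (k : ℝ) ^ p) → 0 < δ → (∃ᶠ k : ℕ in Filter.atTop, ∃ S Sg : Set A.carrier, Literature.Geometry.Kaehler.IsNearlyHolomorphicCycleSupport g.toRiemannianMetric p (C' * (k : ℝ) ^ (-((p : ℝ) + δ))) S Sg ∧ Literature.AlgebraicTopology.SingularHomology.singularCohomology.map ℂ ℂ (⟨Subtype.val, continuous_subtype_val⟩ : C({x : A.carrier // x ∉ S}, A.carrier)) (2 * p) (A.pullback (2 * p) ((m : ℂ) • c + ((a k * d : ℕ) : ℂ) • Literature.AlgebraicGeometry.HodgeTheory.cupPowTwo Λ.hyperplaneClass p)) = 0) → ∃ (k : ℕ) (S : Set A.carrier), (Literature.Geometry.Kaehler.IsAnalyticSet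 𝓘(ℂ, A.model) S ∧ ∀ x ∈ Literature.Geometry.Kaehler.regularLocus 𝓘(ℂ, A.model) S, ∀ q : ℕ, Literature.Geometry.Kaehler.IsRegularPointOfCodim 𝓘(ℂ, A.model) S q x → p ≤ q) ∧ Literature.AlgebraicTopology.SingularHomology.singularCohomology.map ℂ ℂ (⟨Subtype.val, continuous_subtype_val⟩ : C({x : A.carrier // x ∉ S}, A.carrier)) (2 * p) (A.pullback (2 * p) ((m : ℂ) • c + ((a k * d : ℕ) : ℂ) • Literature.AlgebraicGeometry.HodgeTheory.cupPowTwo Λ.hyperplaneClass p)) = 0 :=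
  fun n p X hX hp hp1 hpn => superThresholdRigidityPinned_at_of_hodgeFor n p X hX
    (fun A r hr hrpp => hodgeFor_of_eq_one_or_succ_eq hX hp hp1 A r hr hrpp) hp1 hpn

/-- **R2′ OUTRIGHT for every `n ≤ 3`**: for `1 ≤ p < n ≤ 3` one has `p = 1` or `p + 1 = n`. The statement is
`SuperThresholdRigidityPinned` with its leading `∀ n p X …` restricted by `n ≤ 3`.
[cite: VoisinHodgeI2002, Thm. 6.25, Thm. 11.30 and §11.1.2] -/
theorem superThresholdRigidityPinned_of_le_three : ∀ (n p : ℕ) (X : Literature.AlgebraicGeometry.Motives.SchemeOver ℂ), Literature.AlgebraicGeometry.Motives.IsSmoothProjective n X → n ≤ 3 → 1 ≤ p → p < n → ∀ (A : Literature.AlgebraicGeometry.HodgeTheory.HodgeModel n X) (Λ : Literature.AlgebraicGeometry.HodgeTheory.HardLefschetzNFold n X), Literature.AlgebraicGeometry.HodgeTheory.IsKaehlerClass n X Λ.hyperplaneClass → ∀ (g : Bundle.ContMDiffRiemannianMetric 𝓘(ℝ, A.model) ((⊤ : ℕ∞) : WithTop ℕ∞) A.model (fun x : A.carrier => TangentSpace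 𝓘(ℝ, A.model) x)) (c : Literature.AlgebraicGeometry.HodgeTheory.complexBetti X (2 * p)) (m d : ℕ) (C : ℝ) (a : ℕ → ℕ) (δ C' : ℝ), Literature.AlgebraicGeometry.HodgeTheory.IsRationalClass c → A.pullback (2 * p) c ∈ A.hodgePQ (2 * p) p p → 0 < m → 0 < d → (∀ k, (a k : ℝ) ≤ C * (k : ℝ) ^ p) → 0 < δ → (∃ᶠ k : ℕ in Filter.atTop, ∃ S Sg : Set A.carrier, Literature.Geometry.Kaehler.IsNearlyHolomorphicCycleSupport g.toRiemannianMetric p (C' * (k : ℝ) ^ (-((p : ℝ) + δ))) S Sg ∧ Literature.AlgebraicTopology.SingularHomology.singularCohomology.map ℂ ℂ (⟨Subtype.val, continuous_subtype_val⟩ : C({x : A.carrier // x ∉ S}, A.carrier)) (2 * p) (A.pullback (2 * p) ((m : ℂ) • c + ((a k * d : ℕ) : ℂ) • Literature.AlgebraicGeometry.HodgeTheory.cupPowTwo Λ.hyperplaneClass p)) = 0) → ∃ (k : ℕ) (S : Set A.carrier), (Literature.Geometry.Kaehler.IsAnalyticSet 𝓘(ℂ, A.model) S ∧ ∀ x ∈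 Literature.Geometry.Kaehler.regularLocus 𝓘(ℂ, A.model) S, ∀ q : ℕ, Literature.Geometry.Kaehler.IsRegularPointOfCodim 𝓘(ℂ, A.model) S q x → p ≤ q) ∧ Literature.AlgebraicTopology.SingularHomology.singularCohomology.map ℂ ℂ (⟨Subtype.val, continuous_subtype_val⟩ : C({x : A.carrier // x ∉ S}, A.carrier)) (2 * p) (A.pullback (2 * p) ((m : ℂ) • c + ((a k * d : ℕ) : ℂ) • Literature.AlgebraicGeometry.HodgeTheory.cupPowTwo Λ.hyperplaneClass p)) = 0 :=
  fun n p X hX hn3 hp1 hpn => superThresholdRigidityPinned_at_of_hodgeFor n p X hX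
    (fun A r hr hrpp => hodgeFor_of_eq_one_or_succ_eq hX (by omega) hp1 A r hr hrpp) hp1 hpn

end Summit.HodgeConjecture.HodgeConjecture.Theorems

end
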